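import Summits.CriticalPhenomena.PercolationContinuityZ3.Theorems.PercNearOneGluingNoHeavyLowerTailDConeReduction
import HarnessLib

/-!
# The D-cone (stub `stub_dcone` of stmt-CriticalPhenomena-4575) answers Kozma–Nitzan's Question 7 affirmatively

Support file (`--supports stmt-CriticalPhenomena-4575`), route task `nh-dp-commonrelay`, gen 2.  No definitions, no named facts.

Kozma–Nitzan (arXiv:2401.12397, §5.5 p. 36) ask (**Question 7**): for the relay `a` minimising `P(a ↔ b)` over `A`, does the pre-FKG
inequality (41) `P(0 ↔ b, 0 ↔ A) ≥ P(0 ↔ A, a ↔ b)` hold?  With `b ∈ A` (their normalisation of p. 3: "(3) and (2) are equivalent" once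
`b ∈ A`) the left side is `P(0 ↔ b)`.  The point-observer instance `S = {o}` of the registered residual `stub_dcone` of the
common-relay / Q9 line (block form of (41) against the un-glued minimiser; landed reduction `noHeavyLowerTail_of_dcone`) is exactly this:
gluing a singleton block changes nothing.  Hence:

* (the singleton gluing weighting is the original weighting: the landed `peelGlue_glue_singleton`);
* `kn41_argmin_of_dcone` — `stub_dcone` ⇒ for every finite weighted graph, `b ∈ A`, `o ∉ A` and every minimiser `a₀` of
  `a ↦ μ(a ↔ b)` over `A`: `μ((o ↔ A) ∩ (a₀ ↔ b)) ≤ μ(o ↔ b)` (Question 7: yes);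
* `kn_preFKG2_of_dcone` — hence Kozma–Nitzan's pre-FKG conjecture in the (2)-form `∃ a ∈ A, μ(a ↔ b, o ↔ A) ≤ μ(o ↔ b)`
  (Conjecture 2, p. 3, for `b ∈ A`; the case `o ∈ A` is trivial with `a = o`).
So the registered residual is at least as strong as Conjecture 2 ⊇ Conjecture 1 ⊇ Conjecture 3 of [KozmaNitzan2024] (all open in
print), which places it exactly: `stub_dcone` ⟺ "Question 9 yes for every graph" ⟹ "Question 7 yes" ⟹ Conjecture 2.
[cite: KozmaNitzan2024, §1 (2)–(3) p. 3, §5.5 Question 7 p. 36]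
-/

namespace Summit.CriticalPhenomena.PercolationContinuityZ3.Theorems

open MeasureTheory Set
open Literature.Probability.LatticeModels (prodBernoulli)
open Literature.Probability.Percolation (BondConfig openConn openConnIn openGraph openCluster)
open scoped BigOperators

noncomputable section
open Classical

section Q7OfDCone
open Literature.Probability.LatticeModels Literature.Probability.Percolation

variable {n : ℕ}

/-- **`stub_dcone` ⇒ Kozma–Nitzan Question 7 (yes)**: for the minimiser `a₀` of `a ↦ μ(a ↔ b)` over `A ∋ b` and any observer
`o ∉ A`, `μ((o ↔ A) ∩ (a₀ ↔ b)) ≤ μ(o ↔ b)` — the pre-FKG inequality (41)/(2) at the Question-7 relay.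
[cite: KozmaNitzan2024, §5.5 Question 7 (p. 36), (2)–(3) (p. 3)] -/
theorem kn41_argmin_of_dcone
    (hD : ∀ (n : ℕ) (u : Sym2 (Fin n) → unitInterval) (A S : Finset (Fin n)) (b a₀ : Fin n),
      b ∈ A → Disjoint S A → a₀ ∈ A →
      (∀ a ∈ A, (prodBernoulli u).real (openConn a₀ b) ≤ (prodBernoulli u).real (openConn a b)) →
      (prodBernoulli (fun e : Sym2 (Fin n) => if (∀ y ∈ e, y ∈ S) ∧ ¬ e.IsDiag then 1 else u e)).real
          ((⋃ v ∈ S, ⋃ a ∈ A, openConn v a) ∩ openConn a₀ b)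
        ≤ (prodBernoulli (fun e : Sym2 (Fin n) => if (∀ y ∈ e, y ∈ S) ∧ ¬ e.IsDiag then 1 else u e)).real
          (⋃ v ∈ S, openConn v b))
    (u : Sym2 (Fin n) → unitInterval) (A : Finset (Fin n)) (o b a₀ : Fin n)
    (hb : b ∈ A) (ho : o ∉ A) (ha₀ : a₀ ∈ A)
    (hmin : ∀ a ∈ A, (prodBernoulli u).real (openConn a₀ b) ≤ (prodBernoulli u).real (openConn a b)) :
    (prodBernoulli u).real ((⋃ a ∈ A, (openConn o a : Set (BondConfig (Fin n)))) ∩ openConn a₀ b)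
      ≤ (prodBernoulli u).real (openConn o b) := by
  have hdisj : Disjoint ({o} : Finset (Fin n)) A := Finset.disjoint_singleton_left.2 ho
  have h := hD n u A {o} b a₀ hb hdisj ha₀ hmin
  rw [peelGlue_glue_singleton u o] at h
  have h1 : (⋃ v ∈ ({o} : Finset (Fin n)), ⋃ a ∈ A, (openConn v a : Set (BondConfig (Fin n)))) = ⋃ a ∈ A, openConn o a := by
    ext ω; simp
  have h2 : (⋃ v ∈ ({o} : Finset (Fin n)), (openConn v b : Set (BondConfig (Fin n)))) = openConn o b := by
    ext ω; simp
  rw [h1, h2] at h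
  exact h

/-- **`stub_dcone` ⇒ Kozma–Nitzan's pre-FKG Conjecture 2 in the (2)-form** (`b ∈ A`): some relay `a ∈ A` has
`μ(a ↔ b, o ↔ A) ≤ μ(o ↔ b)` — namely the Question-7 relay if `o ∉ A`, and `a = o` if `o ∈ A`.
[cite: KozmaNitzan2024, Conjecture 2 and (2) (p. 3), Question 7 (p. 36)] -/
theorem kn_preFKG2_of_dcone
    (hD : ∀ (n : ℕ) (u : Sym2 (Fin n) → unitInterval) (A S : Finset (Fin n)) (b a₀ : Fin n),
      b ∈ A → Disjoint S A → a₀ ∈ A →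
      (∀ a ∈ A, (prodBernoulli u).real (openConn a₀ b) ≤ (prodBernoulli u).real (openConn a b)) →
      (prodBernoulli (fun e : Sym2 (Fin n) => if (∀ y ∈ e, y ∈ S) ∧ ¬ e.IsDiag then 1 else u e)).real
          ((⋃ v ∈ S, ⋃ a ∈ A, openConn v a) ∩ openConn a₀ b)
        ≤ (prodBernoulli (fun e : Sym2 (Fin n) => if (∀ y ∈ e, y ∈ S) ∧ ¬ e.IsDiag then 1 else u e)).real
          (⋃ v ∈ S, openConn v b))
    (u : Sym2 (Fin n) → unitInterval) (A : Finset (Fin n)) (o b : Fin n) (hb : b ∈ A) :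
    ∃ a ∈ A, (prodBernoulli u).real (openConn a b ∩ ⋃ a' ∈ A, (openConn o a' : Set (BondConfig (Fin n))))
      ≤ (prodBernoulli u).real (openConn o b) := by
  by_cases ho : o ∈ A
  · refine ⟨o, ho, measureReal_mono (fun ω hω => hω.1) (measure_ne_top _ _)⟩
  · obtain ⟨a₀, ha₀, hmin⟩ := Finset.exists_min_image A (fun a => (prodBernoulli u).real (openConn a b)) ⟨b, hb⟩
    refine ⟨a₀, ha₀, ?_⟩
    rw [Set.inter_comm]
    exact kn41_argmin_of_dcone hD u A o b a₀ hb ho ha₀ hmin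

end Q7OfDCone

end

end Summit.CriticalPhenomena.PercolationContinuityZ3.Theorems
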